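import Summits.QuantumFields.YangMills.Theorems.BalabanUVNodesN15TwoGridMeanZeroMultiplier
import HarnessLib

/-!
# N15 (NE2) — PROGRAMME M «MEAN-ZERO MULTIPLIERS», part M-C: THE CELL SWEEP IS THE BLOCK AVERAGE OVER KING's FIBRES (Fubini on the cell), HENCE ★★★ THE ZEROTH-ORDER
# COEFFICIENT LAYER WITH THE BLOCK-AVERAGED COARSE PARTNER NEEDS NO FIT LETTER AT ALL

WHO ∕ WHEN.  Cell `pub-ymgap`, seat `pub-ymgap-dag-n15-a` (KNIT-BY-NAME seat of Track-A DAG node N15 = NE2, g24); `--kind proof --supports stmt-QuantumFields-27366 --as helper` (K3⁸;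
count-neutral).  Over parts M-A∕M-B (`cellOff`, `linePt`, `lineMean`, `cellSweep`, `boxPt_boxPt`, `cellOff_boxPt`, `kingPr_boxPt`, `hasMaj_comp_mulOp_sub_cellSweep_pull`), part 70
(`boxPt`, `boxPt_val`, `boxPt_injective`) and `T4EtaRateCoeffDefect` (`fibre`, `blockAvg`, `pull`) BY NAME; nothing in the tree is modified.
WHY.  M-B bounds the CELL-OSCILLATING part `w − cellSweep (d+1) w` of any bounded multiplier behind a source-divergence letter by one rate factor.  THIS FILE identifies the
cell-constant remainder: `cellSweep (d+1) w = P(blockAvg_π w)` — the iterated line means ARE the average over King's fibre (Fubini on the `(L^m)^{d+1}` points of the cell).  Consequence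
for the lineage's zeroth-order background carriers, whose coarse partner IS the block average (n15-b convention (C3), `T4EtaRate.EtaPairing.avg := blockAvg π`): the two-grid defect
multiplier `c′ − (blockAvg c′)∘π` IS the oscillating part, so `T′ ∘ 𝔇(M_{c′}, M_{blockAvg c′}) = T′ ∘ M_{c′ − cellSweep c′} ∘ P ≤ 2(d+1)·sup|c′|·L^{−k}·K` with NO oscillation ∕ fit ∕ gradient
letter on `c′` — only its sup ((3.35)'s `|c′| ≤ O(1)Mα₀`) and the source-divergence letters of `T′`.
WHAT ([folklore]; one plumbing `def`).  §6 `offMerge j s r` (the offset vector with the first `j` offsets replaced by `s`), `cellSweep_apply_eq_sum` (★ the `j`-fold partial Fubini: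
`(cellSweep j g)(x′, a) = ℓ^{−j}·Σ_{s : Fin j → Fin ℓ} g(boxPt x′ (offMerge j s (cellOff x′)), a)`), `fibre_kingPrV_eq_image` (King's fibre of `π(x′, a)` = the `(L^m)^{d+1}` cell points
`(boxPt x′ t, a)`), ★★ `cellSweep_eq_pull_blockAvg` (`cellSweep (d+1) g = pull π (blockAvg π g)`).  §7 ★★★ `hasMaj_comp_idef_mulOp_blockAvg_of_divAdj`: for ANY bounded fine multiplier
`c′` (`|c′| ≤ r`) and `T′` with source-divergence letters `T′∘ρ′(n′(s_κ⁻¹−1)) ≤ K` (all `κ`): `T′ ∘ 𝔇(M_{c′}, M_{blockAvg π c′}) ≤ 2(d+1)·r·(L^k)⁻¹·K` — compare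
`T4EtaRateCoeffDefect.hasMaj_idef_mulOp_blockAvg`, which needs the oscillation letter `FibreOsc π c′ o` and pays `o` (for the zeroth-order coefficient `o` is (3.36)-strength).
HONEST FRAMING ∕ LIMITS.  Finite-lattice algebra + block-majorant bookkeeping on the `U ≡ 1` torus MODEL carriers (King's pairing, unit blocks, the linearised transport (C3)); the
source-divergence letter is a HYPOTHESIS (inhabited for `Δ_a⁻¹` at `U ≡ 1` by (1.110) entry 2); no estimate of [B5]∕[B6]∕[B9] asserted; NE2⁺ NOT printed ∕ proved; no statement of record
touched; N15 NOT discharged; K3⁸ OPEN; counts UNMOVED (typed 28∕28 · discharged 5∕27); one finite torus pair per index — NOT infinite volume ∕ OS ∕ mass gap ∕ Clay.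
-/

open scoped BigOperators
open Finset

namespace Summit.QuantumFields.YangMills.BalabanUVNodes.N15.TwoGrid

open Literature.MathematicalPhysics.QuantumFieldTheory.Balaban1983to89
open Literature.MathematicalPhysics.QuantumFieldTheory.Balaban1983to89.B11SectG (BlockNorm HasMaj)
open Literature.MathematicalPhysics.QuantumFieldTheory.Balaban1983to89.T4EtaRateDefect (idef)
open Literature.MathematicalPhysics.QuantumFieldTheory.Balaban1983to89.T4EtaRateCoeffDefect (pull pull_apply fibre mem_fibre blockAvg idef_mulOp_eq)
open Literature.MathematicalPhysics.QuantumFieldTheory.Balaban1983to89.B6Prop26Gluing (mulOp mulOp_apply)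
open Literature.MathematicalPhysics.QuantumFieldTheory.Balaban1983to89.B5Prop11Plancherel (Tor fine unitVec)
open Literature.MathematicalPhysics.QuantumFieldTheory.King1986.Torus (blockOf)
open Literature.MathematicalPhysics.QuantumFieldTheory.Balaban1983to89.B6UnitTorusCarrier (unitTorusGeo)
open Summit.QuantumFields.YangMills.BalabanUVNodes.N15.VectorPiece (blkFine kingPr kingPrV kingPr_val kingPrV_eq)

variable {d : ℕ}

/-! ## §6 Fubini on the cell: the sweep is the block average over King's fibre -/

section Fubini

variable (M : Fin (d + 1) → ℕ) [∀ μ, NeZero (M μ)] (n : ℕ) [NeZero n] {ℓ : ℕ}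

/-- the offset vector whose first `j` entries are `s` and whose other entries are `r`. [folklore] -/
def offMerge (j : ℕ) (s : Fin j → ℕ) (r : Fin (d + 1) → ℕ) : Fin (d + 1) → ℕ := fun i => if h : (i : ℕ) < j then s ⟨i, h⟩ else r i

omit [∀ μ, NeZero (M μ)] [NeZero n] in
/-- with no replaced entry the offset vector is `r`. [folklore] -/
theorem offMerge_zero (s : Fin 0 → ℕ) (r : Fin (d + 1) → ℕ) : offMerge (d := d) 0 s r = r := by
  funext i; simp [offMerge]

omit [∀ μ, NeZero (M μ)] [NeZero n] in
/-- replacing the `j`-th entry of `offMerge j s r` by `i` is `offMerge (j+1) (snoc s i) r` (`j < d + 1`). [folklore] -/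
theorem offMerge_update {j : ℕ} (hj : j < d + 1) (s : Fin j → ℕ) (r : Fin (d + 1) → ℕ) (i : ℕ) :
    Function.update (offMerge j s r) ⟨j, hj⟩ i = offMerge (j + 1) (Fin.snoc s i) r := by
  funext a
  rcases eq_or_ne a ⟨j, hj⟩ with rfl | ha
  · rw [Function.update_self, offMerge, dif_pos (Nat.lt_succ_self j)]
    exact (Fin.snoc_last (α := fun _ => ℕ) (x := i) (p := s)).symm
  · rw [Function.update_of_ne ha, offMerge, offMerge]
    have hav : (a : ℕ) ≠ j := fun h => ha (Fin.ext h)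
    by_cases h1 : (a : ℕ) < j
    · rw [dif_pos h1, dif_pos (Nat.lt_succ_of_lt h1)]
      have e : (⟨a, Nat.lt_succ_of_lt h1⟩ : Fin (j + 1)) = Fin.castSucc ⟨a, h1⟩ := rfl
      rw [e, Fin.snoc_castSucc]
    · have h2 : ¬ (a : ℕ) < j + 1 := by omega
      rw [dif_neg h1, dif_neg h2]

omit [∀ μ, NeZero (M μ)] [NeZero n] in
/-- `offMerge j s r` does not depend on the `j`-th entry of `r`'s update… : updating `r` at index `⟨j, hj⟩` BEFORE merging the first `j` entries is invisible beyond them only at `j`;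
precisely `offMerge j s (update r ⟨j,hj⟩ i) = update (offMerge j s r) ⟨j,hj⟩ i`. [folklore] -/
theorem offMerge_update_right {j : ℕ} (hj : j < d + 1) (s : Fin j → ℕ) (r : Fin (d + 1) → ℕ) (i : ℕ) :
    offMerge j s (Function.update r ⟨j, hj⟩ i) = Function.update (offMerge j s r) ⟨j, hj⟩ i := by
  funext a
  rcases eq_or_ne a ⟨j, hj⟩ with rfl | ha
  · rw [Function.update_self, offMerge, dif_neg (lt_irrefl j), Function.update_self]
  · rw [Function.update_of_ne ha, offMerge, offMerge, Function.update_of_ne ha]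

/-- entries of a merged offset vector are `< ℓ` when `s < ℓ` and `r < ℓ`. [folklore] -/
theorem offMerge_lt {j : ℕ} {s : Fin j → ℕ} {r : Fin (d + 1) → ℕ} (hs : ∀ a, s a < ℓ) (hr : ∀ i, r i < ℓ) (i : Fin (d + 1)) : offMerge j s r i < ℓ := by
  unfold offMerge; split_ifs
  · exact hs _
  · exact hr i

/-- ★ **PARTIAL FUBINI**: `(cellSweep j g)(x′, a) = ℓ^{−j}·Σ_{s : Fin j → Fin ℓ} g(boxPt x′ (offMerge j s (cellOff x′)), a)` (`ℓ ∣ n`, `j ≤ d + 1`). [folklore] -/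
theorem cellSweep_apply_eq_sum (hℓn : ℓ ∣ n) {j : ℕ} (hj : j ≤ d + 1) (g : Tor (fine n M) × Fin (d + 1) → ℝ) (x : Tor (fine n M)) (a : Fin (d + 1)) :
    cellSweep M n ℓ j g (x, a) = ((ℓ : ℝ) ^ j)⁻¹ * ∑ s : Fin j → Fin ℓ, g (boxPt M n ℓ x (offMerge j (fun b => (s b : ℕ)) (cellOff M n ℓ x)), a) := by
  have hℓ0 : 0 < ℓ := Nat.pos_of_dvd_of_pos hℓn (Nat.pos_of_ne_zero (NeZero.ne n))
  have hℓr : (ℓ : ℝ) ≠ 0 := Nat.cast_ne_zero.mpr hℓ0.ne'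
  induction j generalizing x with
  | zero =>
    rw [cellSweep_zero, LinearMap.id_apply, pow_zero, inv_one, one_mul, Fintype.sum_unique]
    simp only [offMerge_zero]
    rw [boxPt_cellOff]
  | succ j ih =>
    have hj' : j < d + 1 := Nat.lt_of_succ_le hj
    rw [cellSweep_succ M n hj', LinearMap.comp_apply, lineMean_apply]
    -- rewrite each line point's partial sum through the corner of `x`
    have hterm : ∀ i ∈ range ℓ, cellSweep M n ℓ j g (linePt M n ℓ ⟨j, hj'⟩ x i, a) =
        ((ℓ : ℝ) ^ j)⁻¹ * ∑ s : Fin j → Fin ℓ, g (boxPt M n ℓ x (offMerge (j + 1) (Fin.snoc (fun b => (s b : ℕ)) i) (cellOff M n ℓ x)), a) := by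
      intro i hi
      rw [ih (le_of_lt hj')]
      congr 1
      refine Fintype.sum_congr _ _ fun s => ?_
      have ht : ∀ b, Function.update (cellOff M n ℓ x) ⟨j, hj'⟩ i b < ℓ := update_cellOff_lt M n hℓ0 x ⟨j, hj'⟩ (mem_range.mp hi)
      rw [linePt, cellOff_boxPt M n hℓn x ht, boxPt_boxPt M n hℓn x ht, offMerge_update_right hj', offMerge_update hj']
    rw [sum_congr rfl hterm, ← mul_sum, ← mul_assoc, pow_succ, mul_inv, mul_comm (((ℓ : ℝ) ^ j)⁻¹)]
    congr 1
    -- `Σ_{i<ℓ} Σ_{s : Fin j → Fin ℓ} F(snoc s i) = Σ_{s′ : Fin (j+1) → Fin ℓ} F s′`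
    rw [← Fin.sum_univ_eq_sum_range (fun i => ∑ s : Fin j → Fin ℓ, g (boxPt M n ℓ x (offMerge (j + 1) (Fin.snoc (fun b => (s b : ℕ)) i) (cellOff M n ℓ x)), a)) ℓ,
      ← Fintype.sum_prod_type']
    refine Fintype.sum_equiv ((Fin.snocEquiv fun _ => Fin ℓ)) _ _ fun p => ?_
    have hS : (Fin.snoc (fun b => (p.2 b : ℕ)) (p.1 : ℕ) : Fin (j + 1) → ℕ) = fun b => ((Fin.snocEquiv (fun _ => Fin ℓ) p b : Fin ℓ) : ℕ) := by
      funext b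
      simp only [Fin.snocEquiv_apply]
      rcases Fin.eq_castSucc_or_eq_last b with ⟨b', rfl⟩ | rfl
      · simp only [Fin.snoc_castSucc]
      · simp only [Fin.snoc_last]
    rw [hS]

omit [∀ μ, NeZero (M μ)] [NeZero n] in
/-- with all `d + 1` entries replaced the offset vector is `s`. [folklore] -/
theorem offMerge_full (s : Fin (d + 1) → ℕ) (r : Fin (d + 1) → ℕ) : offMerge (d + 1) s r = s := by
  funext i
  rw [offMerge, dif_pos i.is_lt]

/-- ★ THE FULL SWEEP IS THE CELL MEAN: `(cellSweep (d+1) g)(x′, a) = ℓ^{−(d+1)}·Σ_{t ∈ [0,ℓ)^{d+1}} g(boxPt x′ t, a)` (part 70's `subAvg`, pointwise). [folklore] -/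
theorem cellSweep_full_apply (hℓn : ℓ ∣ n) (g : Tor (fine n M) × Fin (d + 1) → ℝ) (x : Tor (fine n M)) (a : Fin (d + 1)) :
    cellSweep M n ℓ (d + 1) g (x, a) = ((ℓ : ℝ) ^ (d + 1))⁻¹ * ∑ t : Fin (d + 1) → Fin ℓ, g (boxPt M n ℓ x (fun i => (t i : ℕ)), a) := by
  rw [cellSweep_apply_eq_sum M n hℓn le_rfl]
  simp only [offMerge_full]

/-- the digits collapse: `n⌊v∕n⌋ + ℓ⌊(v mod n)∕ℓ⌋ = ℓ⌊v∕ℓ⌋` (`ℓ ∣ n`). [folklore] -/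
theorem digits_eq_mul_div (hℓn : ℓ ∣ n) (v : ℕ) : n * (v / n) + ℓ * ((v % n) / ℓ) = ℓ * (v / ℓ) := by
  obtain ⟨c, rfl⟩ := hℓn
  have hℓ0 : 0 < ℓ := Nat.pos_of_mul_pos_right (Nat.pos_of_ne_zero (NeZero.ne (ℓ * c)))
  have h1 : v = ℓ * c * (v / (ℓ * c)) + v % (ℓ * c) := (Nat.div_add_mod v (ℓ * c)).symm
  have h2 : v % (ℓ * c) = ℓ * ((v % (ℓ * c)) / ℓ) + (v % (ℓ * c)) % ℓ := (Nat.div_add_mod _ ℓ).symm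
  have h3 : v / ℓ = c * (v / (ℓ * c)) + (v % (ℓ * c)) / ℓ := by
    conv_lhs => rw [h1, h2]
    rw [show ℓ * c * (v / (ℓ * c)) + (ℓ * ((v % (ℓ * c)) / ℓ) + (v % (ℓ * c)) % ℓ) = ((v % (ℓ * c)) % ℓ) + ℓ * (c * (v / (ℓ * c)) + (v % (ℓ * c)) / ℓ) by ring,
      Nat.add_mul_div_left _ _ hℓ0, Nat.div_eq_of_lt (Nat.mod_lt _ hℓ0), zero_add]
  rw [h3]
  ring

variable (L k m : ℕ) [NeZero L]

/-- the coordinates of a cell point through King's pairing: `(boxPt x′ t)_i = L^m·(pr x′)_i + t_i` as a residue. [cite: King1986, p.664 (pairing convention «x′ ∈ B^n(x)»)] -/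
theorem boxPt_apply_eq_kingPr (x : Tor (fine (L ^ m * L ^ k) M)) (t : Fin (d + 1) → ℕ) (i : Fin (d + 1)) :
    boxPt M (L ^ m * L ^ k) (L ^ m) x t i = ((L ^ m * (kingPr L k m M x i).val + t i : ℕ) : ZMod (fine (L ^ m * L ^ k) M i)) := by
  rw [boxPt, kingPr_val, digits_eq_mul_div (L ^ m * L ^ k) (Dvd.intro _ rfl)]

/-- two fine points with the same King parent have the same cell points. [cite: King1986, p.664 (pairing convention)] -/
theorem boxPt_congr_of_kingPr_eq {x z : Tor (fine (L ^ m * L ^ k) M)} (h : kingPr L k m M z = kingPr L k m M x) (t : Fin (d + 1) → ℕ) :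
    boxPt M (L ^ m * L ^ k) (L ^ m) z t = boxPt M (L ^ m * L ^ k) (L ^ m) x t := by
  funext i
  rw [boxPt_apply_eq_kingPr, boxPt_apply_eq_kingPr, h]

/-- ★ **KING's FIBRE IS THE CELL**: the fibre of `π = kingPrV L k m M` over `π(x′, a)` is the image of `t ↦ (boxPt x′ t, a)` over the `(L^m)^{d+1}` offsets. [cite: King1986, p.664 (pairing convention «x′ ∈ B^n(x)»)] -/
theorem fibre_kingPrV_eq_image (x : Tor (fine (L ^ m * L ^ k) M)) (a : Fin (d + 1)) :
    fibre (kingPrV L k m M) (kingPrV L k m M (x, a)) =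
      Finset.univ.image (fun t : Fin (d + 1) → Fin (L ^ m) => (boxPt M (L ^ m * L ^ k) (L ^ m) x (fun i => (t i : ℕ)), a)) := by
  classical
  have hℓ0 : 0 < L ^ m := pow_pos (Nat.pos_of_ne_zero (NeZero.ne L)) m
  ext z
  rw [mem_fibre, Finset.mem_image]
  constructor
  · intro hz
    rw [kingPrV_eq, kingPrV_eq, Prod.mk.injEq] at hz
    refine ⟨fun i => ⟨cellOff M (L ^ m * L ^ k) (L ^ m) z.1 i, cellOff_lt M _ hℓ0 z.1 i⟩, Finset.mem_univ _, ?_⟩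
    refine Prod.ext ?_ hz.2.symm
    show boxPt M (L ^ m * L ^ k) (L ^ m) x (cellOff M (L ^ m * L ^ k) (L ^ m) z.1) = z.1
    rw [← boxPt_congr_of_kingPr_eq M L k m hz.1, boxPt_cellOff]
  · rintro ⟨t, _, rfl⟩
    rw [kingPrV_eq, kingPrV_eq, kingPr_boxPt M L k m x fun i => (t i).is_lt]

/-- ★★ **THE CELL SWEEP IS THE BLOCK AVERAGE OVER KING's FIBRES**: `cellSweep (d+1) g = P(blockAvg_π g)` (`P = pull (kingPrV L k m M)`, cells of side `L^m` on the `η′` torus) — the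
composite of the `d + 1` line means IS n15-b's linearised background transport (C3) `T4EtaRateCoeffDefect.blockAvg`, prolongated. [folklore] -/
theorem cellSweep_eq_pull_blockAvg (g : Tor (fine (L ^ m * L ^ k) M) × Fin (d + 1) → ℝ) :
    cellSweep M (L ^ m * L ^ k) (L ^ m) (d + 1) g = pull (kingPrV L k m M) (blockAvg (kingPrV L k m M) g) := by
  classical
  have hℓn : L ^ m ∣ L ^ m * L ^ k := Dvd.intro _ rfl
  funext z
  obtain ⟨x, a⟩ := z
  have hinj : Function.Injective (fun t : Fin (d + 1) → Fin (L ^ m) => (boxPt M (L ^ m * L ^ k) (L ^ m) x (fun i => (t i : ℕ)), a)) := fun t t' h =>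
    boxPt_injective M (L ^ m * L ^ k) hℓn x (Prod.mk.inj h).1
  rw [pull_apply, blockAvg, fibre_kingPrV_eq_image, Finset.sum_image fun t _ t' _ h => hinj h, Finset.card_image_of_injective _ hinj, Finset.card_univ,
    Fintype.card_fun, Fintype.card_fin, Fintype.card_fin, cellSweep_full_apply M _ hℓn, div_eq_inv_mul]
  push_cast
  ring

end Fubini

/-! ## §7 ★★★ The zeroth-order coefficient layer with the block-averaged coarse partner: NO fit letter -/

section NoFit

variable {L : ℕ} [NeZero L] (M : Fin (d + 1) → ℕ) [∀ μ, NeZero (M μ)] (k m : ℕ) {F₂ : Type} [AddCommGroup F₂] [Module ℝ F₂]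

/-- ★★★ **THE TWO-GRID DEFECT OF A BOUNDED MULTIPLIER AGAINST ITS BLOCK AVERAGE, BEHIND A SOURCE-DIVERGENCE LETTER, COSTS ONE RATE FACTOR — NO FIT, NO OSCILLATION, NO
GRADIENT LETTER ON THE MULTIPLIER.**  `|c′| ≤ r` and `T′∘ρ′(n′(s_κ⁻¹ − 1)) ≤ K` for every `κ` (`K ≥ 0`) ⟹ `T′ ∘ 𝔇(M_{c′}, M_{blockAvg_π c′}) ≤ 2(d+1)·r·(L^k)⁻¹·K`.  Compare
`T4EtaRateCoeffDefect.hasMaj_idef_mulOp_blockAvg` (needs `FibreOsc π c′ o`, pays `o`): for the ZEROTH-ORDER coefficient of [B9] (3.52) under (3.35) alone no such `o` with a rate exists,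
and none is needed. [cite: Balaban1985BackgroundPropagators, (3.35) p.396, (3.42) p.397 (entry «G∇*», shape), (3.50)–(3.53) p.400 (zeroth-order species, mechanism); King1986, Prop. 3.9
(3.73) p.665 (rate factor L^{−k})] -/
theorem hasMaj_comp_idef_mulOp_blockAvg_of_divAdj {b₂ : BlockNorm (unitTorusGeo L k M) F₂} {T' : (Tor (fine (L ^ m * L ^ k) M) × Fin (d + 1) → ℝ) →ₗ[ℝ] F₂}
    {K : Tor M → Tor M → ℝ} (hK : ∀ y y', 0 ≤ K y y') {c' : Tor (fine (L ^ m * L ^ k) M) × Fin (d + 1) → ℝ} {r : ℝ} (hr : 0 ≤ r) (hc' : ∀ z, |c' z| ≤ r)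
    (hT : ∀ κ : Fin (d + 1), HasMaj (BlockNorm.ofBlocks (unitTorusGeo L k M) (fun i : Tor (fine (L ^ m * L ^ k) M) × Fin (d + 1) => blockOf (L ^ m * L ^ k) M i.1)) b₂
      (T' ∘ₗ symbOp M (L ^ m * L ^ k) (((L ^ m * L ^ k : ℕ) : ℝ) • (sTinv M (L ^ m * L ^ k) κ - 1))) K) :
    HasMaj (BlockNorm.ofBlocks (unitTorusGeo L k M) (blkFine L k M)) b₂
      (T' ∘ₗ idef (pull (kingPrV L k m M)) (pull (kingPrV L k m M)) (mulOp c') (mulOp (blockAvg (kingPrV L k m M) c')))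
      (fun y y' => 2 * (d + 1) * r * (((L ^ k : ℕ) : ℝ))⁻¹ * K y y') := by
  have hid : idef (pull (kingPrV L k m M)) (pull (kingPrV L k m M)) (mulOp c') (mulOp (blockAvg (kingPrV L k m M) c')) =
      mulOp (c' - cellSweep M (L ^ m * L ^ k) (L ^ m) (d + 1) c') ∘ₗ pull (kingPrV L k m M) := by
    rw [idef_mulOp_eq, cellSweep_eq_pull_blockAvg]
    rfl
  rw [hid]
  exact hasMaj_comp_mulOp_sub_cellSweep_pull M k m hK hr hc' hT

end NoFit

end Summit.QuantumFields.YangMills.BalabanUVNodes.N15.TwoGrid
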